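import Mathlib
import Literature.Computability.AlgebraicComplexity.Apolarity
import Literature.Computability.AlgebraicComplexity.ApolarityAction
import Literature.Computability.AlgebraicComplexity.BorderApolarityMembership
import Summits.ValiantsHypothesis.ValiantsHypothesis.Theorems.BorderApolarityToricFixedPointsToricLimitIsInitial
import Summits.ValiantsHypothesis.ValiantsHypothesis.Theorems.BorderApolarityFixedWitnessObstructionQPNecessity
import Summits.ValiantsHypothesis.ValiantsHypothesis.Theorems.BorderApolarityToricWitnessObstructionQPStableNormalFormIff
import Summits.ValiantsHypothesis.ValiantsHypothesis.Theorems.BorderApolarityToricFixedPointsFormToTopAux1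

/-!
# Border apolarity, crux `ToricFixedPoints` — the limit top form feeds the degree-`m` toric match (F2)

Route `ValiantsHypothesis/BorderApolarity`, crux item `stmt-ValiantsHypothesis-5779`
(`Summit.ValiantsHypothesis.ValiantsHypothesis.Theses.BorderApolarity.ToricFixedPoints`), strategist line
`form-then-lift`, stub `stub_formToTop` (F2).

Claim.  Assume the FORM-level de-bordering statement F1 at `(n, m)`: every nonzero coefficientwise
limit `F` of rescaled translates `c_t • P_t`, `P_t ∈ GL·det_m`, whose line is fixed by the
`H₀(n,m)`-block (`M·F = e•F`) is `a • u·(top w-component of g·det_m)`.  Then for every `(P, J)` with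
W1 (orbit), W2 ∧ W3 (`J` is the degree-wise Kuratowski limit of the annihilators `Ann_k(P_t)`,
`k ≤ m`) and W4 (`H₀`-stability of `J`) there are `u, g ∈ GL_{m²}` and integer weights `w` such that
the toric curve `Q_t = u·diag((t+2)^w)·g·det_m` matches `J` in degree `m`: (Li)_m ∧ (Ls)_m.

Proof (steps 1–3 are the helper file `…BorderApolarityToricFixedPointsFormToTopAux1`).
1. `ftt_exists_limitForm` — the weighted coefficient vectors of the degree-`m` forms `P_t ≠ 0`,
   normalised to the unit sphere of the finite coordinate space, have a convergent subsequence
   (`IsCompact.tendsto_subseq`); this gives `φ` strictly monotone, scalars `c_t ≠ 0` and a form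
   `F ≠ 0` of degree `m` with `c_t • P_{φ t} → F` coefficientwise, and `J m = Ann_m(F)`:
   "⊆" by passing to the limit in the top-degree pairing (`ftt_apolarAction_eq_zero_of_tendsto`,
   clause (Li)), "⊇" by corrected annihilators (`Socle.mem_of_apolarAction_limit_eq_zero`, clause (Ls)).
2. `ftt_exists_eq_smul_of_stable` — W4 transports to `Ann_m(F) ⊆ Ann_m(M·F)`
   (`apolarAction_linSubst_eq_zero_iff`), and two hyperplanes in containment have proportional
   normals (`Socle.exists_eq_smul_of_apolar_imp`): `M·F = e • F`.  So F1 applies to `(P ∘ φ, F, c)`.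
3. `formToTop_initialSpan_iff_annTop` — for `f = g·det_m` with all `w`-weights `≤ e` and top component
   `f_e ≠ 0`, the lowest-`w`-weight initial span `in_w(Ann_m f)` equals `Ann_m(f_e)`: "⊆" because
   initial forms of annihilators kill the top component (`initialForm_apolar_topComponent`), "=" by
   dimension (`snf_finrank_initialSpan`: `dim in_w(Ann_m f) = dim Hom_m - 1`, while `Ann_m(f_e)` is a
   proper subspace of `Hom_m` since `∂^{d₀} ⌟ f_e ≠ 0` for `d₀ ∈ supp f_e`).
4. `ftt_toric_of_top` — with `F = a • u·f_e`, `J m = Ann_m(F) = {D : uᵀD ∈ Ann_m(f_e)} =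
   {D : uᵀD ∈ in_w(Ann_m f)}`, which is the degree-`m` Kuratowski limit along `Q_t`
   (`tli_isBorderApolarLimit_toric`, stub S1 of line `bb-cell-state-polytope`).
-/

open MvPolynomial Filter
open scoped BigOperators Matrix Topology
open Literature.Computability.AlgebraicComplexity
open Summit.ValiantsHypothesis.ValiantsHypothesis.Theorems.BorderApolarityFixedWitnessObstructionQP
  (weight_natCast_eq)
open Summit.ValiantsHypothesis.ValiantsHypothesis.Theorems.BorderApolarityToricWitnessObstructionQP
  (snf_weightedHomogeneousComponent_natCast)

namespace Summit.ValiantsHypothesis.ValiantsHypothesis.Theorems.BorderApolarityToricFixedPoints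

-- the mandated summit-side namespace repeats a component by design (single-problem summit)
set_option linter.dupNamespace false

noncomputable section

/-! ## The degree-`m` toric match -/

/-- **A top form proportional to `u·top_w(g·det_m)` gives the degree-`m` toric match.**  If
`J m = Ann_m(F)` with `F = a • u·f_e ≠ 0`, `f_e = weightedHomogeneousComponent w e (g·det_m)`, `e`
bounding the `w`-weights of `g·det_m`, then `J m = {D : uᵀD ∈ in_w(Ann_m(g·det_m))}`
(`formToTop_initialSpan_iff_annTop`, transport of annihilators), which is the degree-`m` Kuratowski limit of
the annihilators along the toric curve `Q_t = u·diag((t+2)^w)·g·det_m`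
(`tli_isBorderApolarLimit_toric`): (Li)_m ∧ (Ls)_m. [folklore] -/
theorem ftt_toric_of_top (m : ℕ) (J : ℕ → Set (MvPolynomial (Fin m × Fin m) ℂ))
    (F : MvPolynomial (Fin m × Fin m) ℂ) (hFne : F ≠ 0)
    (hJ : ∀ D, D ∈ J m ↔ D.IsHomogeneous m ∧ apolarAction D F = 0)
    (u g : Matrix.GeneralLinearGroup (Fin m × Fin m) ℂ) (w : Fin m × Fin m → ℤ) (e : ℤ) (a : ℂ)
    (ha : a ≠ 0)
    (hwt : ∀ d ∈ (linSubst (Fin m × Fin m) ℂ (g : Matrix (Fin m × Fin m) (Fin m × Fin m) ℂ)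
      (detPoly (Fin m) ℂ)).support, Finsupp.weight w d ≤ e)
    (hFeq : F = a • linSubst (Fin m × Fin m) ℂ (u : Matrix (Fin m × Fin m) (Fin m × Fin m) ℂ)
      (weightedHomogeneousComponent w e
        (linSubst (Fin m × Fin m) ℂ (g : Matrix (Fin m × Fin m) (Fin m × Fin m) ℂ) (detPoly (Fin m) ℂ)))) :
    (∀ D ∈ J m, ∃ Ds : ℕ → MvPolynomial (Fin m × Fin m) ℂ,
      (∀ t, (Ds t).IsHomogeneous m ∧ apolarAction (Ds t)
        (linSubst (Fin m × Fin m) ℂ (u : Matrix (Fin m × Fin m) (Fin m × Fin m) ℂ)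
          (linSubst (Fin m × Fin m) ℂ (Matrix.diagonal fun i : Fin m × Fin m => ((t : ℂ) + 2) ^ (w i))
            (linSubst (Fin m × Fin m) ℂ (g : Matrix (Fin m × Fin m) (Fin m × Fin m) ℂ)
              (detPoly (Fin m) ℂ)))) = 0) ∧
      Tendsto (fun t => coeffVec (Ds t)) atTop (𝓝 (coeffVec D))) ∧
    (∀ (D : MvPolynomial (Fin m × Fin m) ℂ) (φ : ℕ → ℕ) (Ds : ℕ → MvPolynomial (Fin m × Fin m) ℂ),
      StrictMono φ →
      (∀ t, (Ds t).IsHomogeneous m ∧ apolarAction (Ds t)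
        (linSubst (Fin m × Fin m) ℂ (u : Matrix (Fin m × Fin m) (Fin m × Fin m) ℂ)
          (linSubst (Fin m × Fin m) ℂ
            (Matrix.diagonal fun i : Fin m × Fin m => (((φ t : ℕ) : ℂ) + 2) ^ (w i))
            (linSubst (Fin m × Fin m) ℂ (g : Matrix (Fin m × Fin m) (Fin m × Fin m) ℂ)
              (detPoly (Fin m) ℂ)))) = 0) →
      Tendsto (fun t => coeffVec (Ds t)) atTop (𝓝 (coeffVec D)) → D ∈ J m) := by
  classical
  have hU : IsUnit (u : Matrix (Fin m × Fin m) (Fin m × Fin m) ℂ).det := Matrix.isUnits_det_units u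
  have hUT : IsUnit (u : Matrix (Fin m × Fin m) (Fin m × Fin m) ℂ)ᵀ.det :=
    Matrix.isUnit_det_transpose _ hU
  have hfene : weightedHomogeneousComponent w e
      (linSubst (Fin m × Fin m) ℂ (g : Matrix (Fin m × Fin m) (Fin m × Fin m) ℂ) (detPoly (Fin m) ℂ)) ≠ 0 := by
    intro h0
    apply hFne
    rw [hFeq, h0, map_zero, smul_zero]
  have htor := tli_isBorderApolarLimit_toric m (u : Matrix (Fin m × Fin m) (Fin m × Fin m) ℂ) hU w
    (linSubst (Fin m × Fin m) ℂ (g : Matrix (Fin m × Fin m) (Fin m × Fin m) ℂ) (detPoly (Fin m) ℂ))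
  -- identify `J m` with the translated initial span
  have hJS : J m = {D | linSubst (Fin m × Fin m) ℂ (u : Matrix (Fin m × Fin m) (Fin m × Fin m) ℂ)ᵀ D ∈
      Submodule.span ℂ {D' : MvPolynomial (Fin m × Fin m) ℂ | ∃ E ∈ annihilatorOfDegree
          (linSubst (Fin m × Fin m) ℂ (g : Matrix (Fin m × Fin m) (Fin m × Fin m) ℂ) (detPoly (Fin m) ℂ)) m,
        ∃ ν : ℤ, D' = weightedHomogeneousComponent w ν E ∧
          ∀ ν' : ℤ, ν' < ν → weightedHomogeneousComponent w ν' E = 0}} := by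
    ext D
    rw [hJ D, Set.mem_setOf_eq, formToTop_initialSpan_iff_annTop m g w e hwt hfene _,
      mem_annihilatorOfDegree_iff, hFeq, apolarAction_smul_right, smul_eq_zero, or_iff_right ha,
      apolarAction_linSubst_eq_zero_iff _ hU]
    refine and_congr_left fun _ => ⟨fun h => linSubst_isHomogeneous _ h, fun h => ?_⟩
    have h2 := linSubst_isHomogeneous ((u : Matrix (Fin m × Fin m) (Fin m × Fin m) ℂ)ᵀ)⁻¹ h
    rwa [← AlgHom.comp_apply, ← linSubst_mul, Matrix.nonsing_inv_mul _ hUT, linSubst_one,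
      AlgHom.id_apply] at h2
  rw [hJS]
  exact ⟨htor.1 m le_rfl, htor.2 m le_rfl⟩

/-! ## The stub -/

/-- **F2 — the FORM level feeds the degree-`m` toric match** (stub `stub_formToTop` of line
`form-then-lift`, crux `BorderApolarity.ToricFixedPoints`, stmt-ValiantsHypothesis-5779).  F1 at
`(n, m)` implies: for every `(P, J)` with W1 (orbit), W2 ∧ W3 (Kuratowski limit in degrees `≤ m`) and
W4 (`H₀`-stability) there are `u, g ∈ GL_{m²}` and integer weights `w` whose toric curve
`Q_t = u·diag((t+2)^w)·g·det_m` matches `J` in degree `m` ((Li)_m ∧ (Ls)_m).  Proof: pass to a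
subsequence with `c_t • P_t → F ≠ 0` (compact unit sphere of the degree-`m` coefficient space);
`J_m = Ann_m(F)` by the perfect top pairing (`ftt_exists_limitForm`); W4 gives
`Ann_m(F) ⊆ Ann_m(M·F)`, so `M·F ∝ F` (`ftt_exists_eq_smul_of_stable`); F1 gives
`F = a • u·top_w(g·det_m)`; and `Ann_m` of that top form, translated by `u`, is the degree-`m`
Kuratowski limit along `Q_t` (`ftt_toric_of_top`, over `tli_isBorderApolarLimit_toric` and
`formToTop_initialSpan_iff_annTop`; the weights `w : _ → ℕ` of F1 are cast to `ℤ`).  The inline `act` is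
`apolarAction` by `rfl`; the statement is lines 74–75 of `Lines/form_then_lift.lean` verbatim up to the
opened namespaces `MvPolynomial`, `Filter`, `Literature.Computability.AlgebraicComplexity` (the
registry's 4000-character limit), so it elaborates to the identical proposition. [folklore] -/
theorem stub_formToTop :
    ∀ (n m : ℕ) [NeZero m], 3 ≤ n → n ≤ m → let act := fun (D f : MvPolynomial (Fin m × Fin m) ℂ) => ∑ e ∈ D.support, ∑ d ∈ f.support, monomial (d - e) (coeff e D * coeff d f * ∏ i ∈ e.support, (Nat.descFactorial (d i) (e i) : ℂ)); let rk := fun (p : Fin m × Fin m) => (if (m - n ≤ (p.1 : ℕ) ∧ m - n ≤ (p.2 : ℕ)) ∨ p = (0, 0) then 0 else m * m) + ((p.1 : ℕ) * m + (p.2 : ℕ)); (∀ (P : ℕ → MvPolynomial (Fin m × Fin m) ℂ) (F : MvPolynomial (Fin m × Fin m) ℂ) (c : ℕ → ℂ), (∀ t : ℕ, P t ∈ glOrbit (Fin m × Fin m) ℂ (detPoly (Fin m) ℂ)) → F ≠ 0 → Tendsto (fun t => coeffVec (c t • P t)) atTop (nhds (coeffVec F)) → (∀ A : Matrix.GeneralLinearGroup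 (Fin m × Fin m) ℂ, let M : Matrix (Fin m × Fin m) (Fin m × Fin m) ℂ := A; (∀ i j : Fin m × Fin m, M j i ≠ 0 → rk j ≤ rk i) → (∀ i j : Fin m × Fin m, ((m - n ≤ (i.1 : ℕ) ∧ m - n ≤ (i.2 : ℕ)) ∨ i = (0, 0)) → j ≠ i → M j i = 0) → (∀ i k j l : Fin m, m - n ≤ (i : ℕ) → m - n ≤ (k : ℕ) → m - n ≤ (j : ℕ) → m - n ≤ (l : ℕ) → M (i, j) (i, j) * M (k, l) (k, l) = M (i, l) (i, l) * M (k, j) (k, j)) → M (0, 0) (0, 0) ^ (m - n) * ∏ i ∈ Finset.univ.filter (fun i : Fin m => m - n ≤ (i : ℕ)), M (i, i) (i, i) = 1 → ∃ e : ℂ, linSubst (Fin m × Fin m) ℂ M F = e • F) → ∃ (u g : Matrix.GeneralLinearGroup (Fin m × Fin m) ℂ) (w : Fin m × Fin m → ℕ) (e : ℕ) (a : ℂ), a ≠ 0 ∧ (∀ d ∈ (linSubst (Fin m × Fin m) ℂ (g : Matrix (Fin m × Fin m) (Fin m × Fin m) ℂ) (detPoly (Fin m) ℂ)).support, Finsupp.weight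 w d ≤ e) ∧ F = a • linSubst (Fin m × Fin m) ℂ (u : Matrix (Fin m × Fin m) (Fin m × Fin m) ℂ) (weightedHomogeneousComponent w e (linSubst (Fin m × Fin m) ℂ (g : Matrix (Fin m × Fin m) (Fin m × Fin m) ℂ) (detPoly (Fin m) ℂ)))) → ∀ (P : ℕ → MvPolynomial (Fin m × Fin m) ℂ) (J : ℕ → Set (MvPolynomial (Fin m × Fin m) ℂ)), (∀ t : ℕ, P t ∈ glOrbit (Fin m × Fin m) ℂ (detPoly (Fin m) ℂ)) → (∀ k ≤ m, ∀ D ∈ J k, ∃ Ds : ℕ → MvPolynomial (Fin m × Fin m) ℂ, (∀ t, (Ds t).IsHomogeneous k ∧ act (Ds t) (P t) = 0) ∧ Tendsto (fun t => coeffVec (Ds t)) atTop (nhds (coeffVec D))) ∧ (∀ k ≤ m, ∀ (D : MvPolynomial (Fin m × Fin m) ℂ) (φ : ℕ → ℕ) (Ds : ℕ → MvPolynomial (Fin m × Fin m) ℂ), StrictMono φ → (∀ t, (Ds t).IsHomogeneous k ∧ act (Ds t) (P (φ t)) = 0) → Tendsto (fun t => coeffVec (Ds t)) atTop (nhds (coeffVec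 D)) → D ∈ J k) → (∀ A : Matrix.GeneralLinearGroup (Fin m × Fin m) ℂ, let M : Matrix (Fin m × Fin m) (Fin m × Fin m) ℂ := A; (∀ i j : Fin m × Fin m, M j i ≠ 0 → rk j ≤ rk i) → (∀ i j : Fin m × Fin m, ((m - n ≤ (i.1 : ℕ) ∧ m - n ≤ (i.2 : ℕ)) ∨ i = (0, 0)) → j ≠ i → M j i = 0) → (∀ i k j l : Fin m, m - n ≤ (i : ℕ) → m - n ≤ (k : ℕ) → m - n ≤ (j : ℕ) → m - n ≤ (l : ℕ) → M (i, j) (i, j) * M (k, l) (k, l) = M (i, l) (i, l) * M (k, j) (k, j)) → M (0, 0) (0, 0) ^ (m - n) * ∏ i ∈ Finset.univ.filter (fun i : Fin m => m - n ≤ (i : ℕ)), M (i, i) (i, i) = 1 → ∀ k ≤ m, ∀ D ∈ J k, linSubst (Fin m × Fin m) ℂ Mᵀ D ∈ J k) → ∃ (u g : Matrix.GeneralLinearGroup (Fin m × Fin m) ℂ) (w : Fin m × Fin m → ℤ), let Q : ℕ → MvPolynomial (Fin m × Fin m) ℂ := fun t => linSubst (Fin m × Fin m) ℂ (u : Matrix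 (Fin m × Fin m) (Fin m × Fin m) ℂ) (linSubst (Fin m × Fin m) ℂ (Matrix.diagonal fun i : Fin m × Fin m => ((t : ℂ) + 2) ^ (w i)) (linSubst (Fin m × Fin m) ℂ (g : Matrix (Fin m × Fin m) (Fin m × Fin m) ℂ) (detPoly (Fin m) ℂ))); (∀ D ∈ J m, ∃ Ds : ℕ → MvPolynomial (Fin m × Fin m) ℂ, (∀ t, (Ds t).IsHomogeneous m ∧ act (Ds t) (Q t) = 0) ∧ Tendsto (fun t => coeffVec (Ds t)) atTop (nhds (coeffVec D))) ∧ (∀ (D : MvPolynomial (Fin m × Fin m) ℂ) (φ : ℕ → ℕ) (Ds : ℕ → MvPolynomial (Fin m × Fin m) ℂ), StrictMono φ → (∀ t, (Ds t).IsHomogeneous m ∧ act (Ds t) (Q (φ t)) = 0) → Tendsto (fun t => coeffVec (Ds t)) atTop (nhds (coeffVec D)) → D ∈ J m) := by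
  intro n m _ h3 hnm
  dsimp only
  intro hF1 P J hP hK hS
  -- W1: the `P t` are nonzero forms of degree `m`
  have hPhom : ∀ t, (P t).IsHomogeneous m := fun t => by
    simpa [Fintype.card_fin] using BorderApolarity.isHomogeneous_of_mem_glOrbit_detPoly (hP t)
  have hPne : ∀ t, P t ≠ 0 := fun t => BorderApolarity.ne_zero_of_mem_glOrbit_detPoly (hP t)
  -- the limit top form `F` along a subsequence `φ`, with `J m = Ann_m(F)`
  obtain ⟨F, c, φ, hφ, hFne, hFhom, hcne, hlim, hJ⟩ :=
    ftt_exists_limitForm hPhom hPne (hK.1 m le_rfl) (hK.2 m le_rfl)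
  -- W4 makes `F` an `H₀`-eigenform; apply F1 to `(P ∘ φ, F, c)`
  obtain ⟨u, g, w, e, a, ha, hwt, hFeq⟩ := hF1 (fun t => P (φ t)) F c (fun t => hP (φ t)) hFne hlim
    (fun A h1 h2 h3 h4 => ftt_exists_eq_smul_of_stable hFhom hFne hJ
      (A : Matrix (Fin m × Fin m) (Fin m × Fin m) ℂ) (Matrix.isUnits_det_units A)
      (hS A h1 h2 h3 h4 m le_rfl))
  -- cast the weights to `ℤ` and read off the degree-`m` toric match
  refine ⟨u, g, fun i => (w i : ℤ), ?_⟩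
  have hwt' : ∀ d ∈ (linSubst (Fin m × Fin m) ℂ (g : Matrix (Fin m × Fin m) (Fin m × Fin m) ℂ)
      (detPoly (Fin m) ℂ)).support, Finsupp.weight (fun i => (w i : ℤ)) d ≤ ((e : ℕ) : ℤ) :=
    fun d hd => by
      rw [weight_natCast_eq]
      exact_mod_cast hwt d hd
  rw [← snf_weightedHomogeneousComponent_natCast] at hFeq
  exact ftt_toric_of_top m J F hFne hJ u g (fun i => (w i : ℤ)) (e : ℤ) a ha hwt' hFeq

end

end Summit.ValiantsHypothesis.ValiantsHypothesis.Theorems.BorderApolarityToricFixedPoints
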